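import Mathlib
import Summits.CriticalPhenomena.PercolationContinuityZ3.Theorems.PercBudgetLadderPinholeClosingShellChart
import HarnessLib

/-!
# Crux `PercBudgetLadder.PinholeClosing` (stmt-CriticalPhenomena-5249), line `budget-halving` (shell form) — the shell merge

Helper file of lead `prover-line-stmt-CriticalPhenomena-5249-c3-0` for the reshaped skeleton
`Cruxes/PinholeClosing/Lines/budget_halving.lean`; proves the registered stub `stub_shellMerge`
(`--supports stmt-CriticalPhenomena-5249`).  Deterministic, lattice configurations, tree vocabulary only.

Setting: scale `u ≥ 1`, source radius `n ∈ [2u, 3u]`, aspect `l ≥ 2`, budget `j ≥ 1`; the grid translates are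
`u • z`, `z ∈ ℤ³`, and the SURFACE translates are those with `‖z‖∞ = 4l` (`z ∈ box 3 (4l) ∖ box 3 (4l - 1)`).
CAPS: at every surface translate the window `box n → ∂ⁱⁿ box (3lu)` is blocked after closing `≤ j` edges.
FLOORS: at no surface translate is the window `box u → ∂ⁱⁿ box (12lu)` blocked after closing `≤ j - 1` edges.
CONCLUSION (`stub_shellMerge`): ONE finite `V` with `≤ j` open lattice boundary edges, disjoint from `box u`, inside
`box (12lu - 1)`, containing the sphere `box (4lu) ∖ box (4lu - 1)`.

Proof: the door lemma (`ShellExclusion.door_lemma`) turns each cap into a pocket `U z ⊇ box n + u • z` inside its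
window `box (3lu) + u • z` with `≤ j` open doors; floors in cut form (`ShellExclusion.floor_cut`) give `≥ j` open doors
to every set between the floor box `box u + u • z` and `U z` (such a set misses the far sphere of radius `12lu`); the six
faces of the grid cube `‖z‖∞ = 4l` are affine charts with neighbouring consecutive points, merged one after the other
by `ShellExclusion.chart_merge` (each later face starts at a grid point of an earlier face); every surface translate is
a chart point, so `V ⊇ U z ⊇ box n + u • z` for all of them, and rounding the coordinates of a sphere site down to the
grid (`ShellExclusion.grid_round`, `u ≤ n`) puts it in such a source box; every pocket lives in
`box (7lu) ⊆ box (12lu - 1)` and off `box u` (`lu ≥ 2u`).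

Sources: folklore (submodularity of cut functions; max-flow/min-cut bookkeeping).
-/

noncomputable section

namespace Summit.CriticalPhenomena.PercolationContinuityZ3.Theorems

open MeasureTheory
open scoped Classical
open Literature.Probability.Percolation Literature.Probability.LatticeModels
open Summit.CriticalPhenomena.PercolationContinuityZ3.Theorems.PinholeClosing.Negative
open Summit.CriticalPhenomena.PercolationContinuityZ3.Theorems.PocketResampling (openBdry)

open ShellExclusion

/-- **Registered stub `stub_shellMerge`** of the crux skeleton (line `budget-halving`, shell form).  Scale `u ≥ 1`,
source radius `n ∈ [2u, 3u]`, aspect `l ≥ 2`, budget `j ≥ 1`.  CAPS: every surface translate `u • z`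
(`z ∈ box 3 (4l) ∖ box 3 (4l-1)`) of the window `box n → ∂ⁱⁿ box (3lu)` is budget-`j` blocked.  FLOORS: no such
translate of the window `box u → ∂ⁱⁿ box (12lu)` is budget-`(j-1)` blocked.  THEN there is a finite `V` with at most
`j` open lattice boundary edges, disjoint from `box u`, inside `box (12lu - 1)`, containing the sphere
`box (4lu) ∖ box (4lu - 1)`.  Proof: door lemma (pockets), floors in cut form, `chart_merge` over the six faces of
the grid cube (each later face starts at a grid point of an earlier face), and the cover of the sphere by the source
boxes (`grid_round`). -/
theorem stub_shellMerge :
    ∀ (j n l u : ℕ) (ω : BondConfig (Site 3)), ω ⊆ (zdGraph 3).edgeSet → 1 ≤ j → 2 ≤ l → 1 ≤ u →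
      2 * u ≤ n → n ≤ 3 * u →
      (∀ z ∈ box 3 (4 * l), z ∉ box 3 (4 * l - 1) →
        ∃ S : Finset (Sym2 (Site 3)), S.card ≤ j ∧ ¬ ∃ x ∈ (box 3 n).image (· + (u : ℤ) • z),
          ∃ y ∈ (innerBoundary (zdGraph 3) (box 3 (3 * l * u))).image (· + (u : ℤ) • z),
            (ω \ (↑S : Set (Sym2 (Site 3)))) ∈
              openConnIn (↑((box 3 (3 * l * u)).image (· + (u : ℤ) • z)) : Set (Site 3)) x y) →
      (∀ z ∈ box 3 (4 * l), z ∉ box 3 (4 * l - 1) →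
        ¬ ∃ S : Finset (Sym2 (Site 3)), S.card ≤ j - 1 ∧ ¬ ∃ x ∈ (box 3 u).image (· + (u : ℤ) • z),
          ∃ y ∈ (innerBoundary (zdGraph 3) (box 3 (12 * l * u))).image (· + (u : ℤ) • z),
            (ω \ (↑S : Set (Sym2 (Site 3)))) ∈
              openConnIn (↑((box 3 (12 * l * u)).image (· + (u : ℤ) • z)) : Set (Site 3)) x y) →
      ∃ V : Finset (Site 3), ((edgeBoundary (zdGraph 3) V).filter (· ∈ ω)).card ≤ j ∧
        Disjoint V (box 3 u) ∧ V ⊆ box 3 (12 * l * u - 1) ∧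
        ∀ x ∈ box 3 (4 * l * u), x ∉ box 3 (4 * l * u - 1) → x ∈ V := by
  intro j n l u ω hω hj hl hu h2u h3u hcaps hfloors
  -- scales (everything is a multiple of the atom `l * u`)
  have hlu : 1 ≤ l * u := Nat.mul_le_mul (by omega : 1 ≤ l) hu
  have h2lu : 2 * u ≤ l * u := Nat.mul_le_mul_right u hl
  have h3 : 3 * u ≤ 3 * l * u := Nat.mul_le_mul_right u (by omega)
  have hnL : n ≤ 3 * l * u := h3u.trans h3
  have hL : ((3 * l * u : ℕ) : ℤ) = 3 * (l * u : ℕ) := by push_cast; ring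
  have hM : ((12 * l * u : ℕ) : ℤ) = 12 * (l * u : ℕ) := by push_cast; ring
  have hR : ((4 * l * u : ℕ) : ℤ) = 4 * (l * u : ℕ) := by push_cast; ring
  have hM1 : ((12 * l * u - 1 : ℕ) : ℤ) = 12 * (l * u : ℕ) - 1 := by
    rw [Nat.cast_sub (by rw [Nat.mul_assoc]; omega), hM]; simp
  have hR1 : ((4 * l * u - 1 : ℕ) : ℤ) = 4 * (l * u : ℕ) - 1 := by
    rw [Nat.cast_sub (by rw [Nat.mul_assoc]; omega), hR]; simp
  have hl1 : ((4 * l - 1 : ℕ) : ℤ) = 4 * (l : ℤ) - 1 := by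
    rw [Nat.cast_sub (by omega)]; simp
  have hul : (u : ℤ) * (4 * l) = 4 * (l * u : ℕ) := by push_cast; ring
  -- pockets (door lemma at every surface translate; `∅` elsewhere)
  have hpock : ∀ z : Site 3, ∃ Uz : Finset (Site 3), z ∈ box 3 (4 * l) → z ∉ box 3 (4 * l - 1) →
      (box 3 n).image (· + (u : ℤ) • z) ⊆ Uz ∧ Uz ⊆ (box 3 (3 * l * u)).image (· + (u : ℤ) • z) ∧
      Disjoint Uz ((innerBoundary (zdGraph 3) (box 3 (3 * l * u))).image (· + (u : ℤ) • z)) ∧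
      openBdry ω Uz ≤ j := by
    intro z
    by_cases hz : z ∈ box 3 (4 * l) ∧ z ∉ box 3 (4 * l - 1)
    · obtain ⟨Uz, h1, h2, h3, h4⟩ := door_lemma hnL (hcaps z hz.1 hz.2)
      exact ⟨Uz, fun _ _ => ⟨h1, h2, h3, h4⟩⟩
    · exact ⟨∅, fun h1 h2 => absurd ⟨h1, h2⟩ hz⟩
  choose U hU using hpock
  -- floors in cut form, inside a pocket
  have hfl : ∀ z ∈ box 3 (4 * l), z ∉ box 3 (4 * l - 1) → ∀ X : Finset (Site 3),
      (box 3 u).image (· + (u : ℤ) • z) ⊆ X → X ⊆ U z → j ≤ openBdry ω X := by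
    intro z hz hz' X hQX hXU
    have hdisj : Disjoint X ((innerBoundary (zdGraph 3) (box 3 (12 * l * u))).image (· + (u : ℤ) • z)) := by
      rw [Finset.disjoint_left]
      intro x hxX hxS
      have hx := (hU z hz hz').2.1 (hXU hxX)
      rw [mem_image_add_iff] at hx hxS
      obtain ⟨i, hi⟩ := exists_eq_of_mem_innerBoundary_box hxS
      have hxi := (mem_box.1 hx) i
      rw [hL] at hxi
      rw [hM] at hi
      rcases hi with hi | hi <;> omega
    have := floor_cut hω (hfloors z hz hz') hQX hdisj
    omega
  -- every pocket of a surface translate lies in `box (7lu)`, off `box u`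
  have hwin : ∀ z ∈ box 3 (4 * l), z ∉ box 3 (4 * l - 1) → ∀ x ∈ U z,
      x ∈ box 3 (12 * l * u - 1) ∧ x ∉ box 3 u := by
    intro z hz hz' x hx
    have hxw := (hU z hz hz').2.1 hx
    rw [mem_image_add_iff, mem_box] at hxw
    simp only [Pi.sub_apply, Pi.smul_apply, smul_eq_mul] at hxw
    rw [mem_box] at hz
    rw [mem_box, not_forall] at hz'
    obtain ⟨i₀, hi₀⟩ := hz'
    have hzi₀ := hz i₀
    rw [hl1] at hi₀
    have hzi : z i₀ = 4 * l ∨ z i₀ = -(4 * l) := by omega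
    have hu0 : (0 : ℤ) ≤ u := by positivity
    constructor
    · rw [mem_box]
      intro i
      have h1 := hxw i
      have h2 := hz i
      push_cast at h2
      rw [hL] at h1
      rw [hM1]
      have hzu : |(u : ℤ) * z i| ≤ 4 * (l * u : ℕ) := by
        rw [abs_mul, abs_of_nonneg hu0, ← hul]
        exact mul_le_mul_of_nonneg_left (abs_le.2 ⟨h2.1, h2.2⟩) hu0
      rw [abs_le] at hzu
      constructor <;> omega
    · intro hxu
      rw [mem_box] at hxu
      have h1 := hxw i₀
      have h3 := hxu i₀
      rw [hL] at h1
      have h22 : (2 * u : ℕ) ≤ (n : ℤ) := by exact_mod_cast h2u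
      push_cast at h22
      rcases hzi with hzi | hzi
      · have : (u : ℤ) * z i₀ = 4 * (l * u : ℕ) := by rw [hzi, hul]
        omega
      · have : (u : ℤ) * z i₀ = -(4 * (l * u : ℕ)) := by rw [hzi, mul_neg, hul]
        omega
  -- the six face charts of the grid cube `‖z‖∞ = 4l` (K = 8l + 1 points a side)
  set K : ℕ := 8 * l + 1 with hK
  set c : ℤ := 4 * (l : ℤ) with hc
  set p₁ : ℕ → ℕ → Site 3 := fun s t => ![-c, (s : ℤ) - c, (t : ℤ) - c] with hp₁
  set p₂ : ℕ → ℕ → Site 3 := fun s t => ![(s : ℤ) - c, -c, (t : ℤ) - c] with hp₂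
  set p₃ : ℕ → ℕ → Site 3 := fun s t => ![(s : ℤ) - c, (t : ℤ) - c, -c] with hp₃
  set p₄ : ℕ → ℕ → Site 3 := fun s t => ![(s : ℤ) - c, c, (t : ℤ) - c] with hp₄
  set p₅ : ℕ → ℕ → Site 3 := fun s t => ![(s : ℤ) - c, (t : ℤ) - c, c] with hp₅
  set p₆ : ℕ → ℕ → Site 3 := fun s t => ![c, (s : ℤ) - c, (t : ℤ) - c] with hp₆
  -- chart points are surface points
  have hsurf : ∀ p : ℕ → ℕ → Site 3, (p = p₁ ∨ p = p₂ ∨ p = p₃ ∨ p = p₄ ∨ p = p₅ ∨ p = p₆) →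
      ∀ s < K, ∀ t < K, p s t ∈ box 3 (4 * l) ∧ p s t ∉ box 3 (4 * l - 1) := by
    intro p hp s hs t ht
    rw [mem_box, mem_box, not_forall, hl1]
    push_cast
    rcases hp with rfl | rfl | rfl | rfl | rfl | rfl
    · exact ⟨fun i => by fin_cases i <;> simp [hp₁, hc] <;> omega, ⟨0, by simp [hp₁, hc]⟩⟩
    · exact ⟨fun i => by fin_cases i <;> simp [hp₂, hc] <;> omega, ⟨1, by simp [hp₂, hc]⟩⟩
    · exact ⟨fun i => by fin_cases i <;> simp [hp₃, hc] <;> omega, ⟨2, by simp [hp₃, hc]⟩⟩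
    · exact ⟨fun i => by fin_cases i <;> simp [hp₄, hc] <;> omega, ⟨1, by simp [hp₄, hc]⟩⟩
    · exact ⟨fun i => by fin_cases i <;> simp [hp₅, hc] <;> omega, ⟨2, by simp [hp₅, hc]⟩⟩
    · exact ⟨fun i => by fin_cases i <;> simp [hp₆, hc] <;> omega, ⟨0, by simp [hp₆, hc]⟩⟩
  -- consecutive chart points are neighbours
  have hadj : ∀ p : ℕ → ℕ → Site 3, (p = p₁ ∨ p = p₂ ∨ p = p₃ ∨ p = p₄ ∨ p = p₅ ∨ p = p₆) →
      (∀ s t, ∀ i, |p s (t + 1) i - p s t i| ≤ 1) ∧ (∀ s, ∀ i, |p (s + 1) 0 i - p s 0 i| ≤ 1) := by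
    intro p hp
    rcases hp with rfl | rfl | rfl | rfl | rfl | rfl <;>
      exact ⟨fun s t i => by fin_cases i <;> simp [hp₁, hp₂, hp₃, hp₄, hp₅, hp₆],
        fun s i => by fin_cases i <;> simp [hp₁, hp₂, hp₃, hp₄, hp₅, hp₆]⟩
  -- one face merged onto a previous set
  have hface : ∀ p : ℕ → ℕ → Site 3, (p = p₁ ∨ p = p₂ ∨ p = p₃ ∨ p = p₄ ∨ p = p₅ ∨ p = p₆) →
      ∀ Prev : Finset (Site 3), openBdry ω Prev ≤ j → U (p 0 0) ⊆ Prev →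
      openBdry ω (Prev ∪ (Finset.range K).biUnion fun s => (Finset.range K).biUnion fun t => U (p s t)) ≤ j := by
    intro p hp Prev hPrev hPrev0
    have hK0 : 0 < K := by omega
    refine chart_merge U p (fun s hs t ht => (hU _ (hsurf p hp s hs t ht).1 (hsurf p hp s hs t ht).2).2.2.2)
      (fun s hs t ht => (hU _ (hsurf p hp s hs t ht).1 (hsurf p hp s hs t ht).2).1)
      (fun s hs t ht => hfl _ (hsurf p hp s hs t ht).1 (hsurf p hp s hs t ht).2) (hadj p hp).1 (hadj p hp).2
      h2u hPrev ((hU _ (hsurf p hp 0 hK0 0 hK0).1 (hsurf p hp 0 hK0 0 hK0).2).1.trans hPrev0)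
  -- the merged shell bag
  set F : (ℕ → ℕ → Site 3) → Finset (Site 3) := fun p =>
    (Finset.range K).biUnion fun s => (Finset.range K).biUnion fun t => U (p s t) with hF
  set V : Finset (Site 3) := U (p₁ 0 0) ∪ F p₁ ∪ F p₂ ∪ F p₃ ∪ F p₄ ∪ F p₅ ∪ F p₆ with hV
  have hK0 : 0 < K := by omega
  have hK8 : 8 * l < K := by omega
  have h00 := hsurf p₁ (Or.inl rfl) 0 hK0 0 hK0
  -- origins of the later faces are points of earlier faces
  have e₂ : p₂ 0 0 = p₁ 0 0 := by ext i; fin_cases i <;> simp [hp₁, hp₂]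
  have e₃ : p₃ 0 0 = p₁ 0 0 := by ext i; fin_cases i <;> simp [hp₁, hp₃]
  have e₄ : p₄ 0 0 = p₁ (8 * l) 0 := by ext i; fin_cases i <;> simp [hp₁, hp₄, hc]; ring
  have e₅ : p₅ 0 0 = p₁ 0 (8 * l) := by ext i; fin_cases i <;> simp [hp₁, hp₅, hc]; ring
  have e₆ : p₆ 0 0 = p₂ (8 * l) 0 := by ext i; fin_cases i <;> simp [hp₂, hp₆, hc]; ring
  have hV1 : openBdry ω (U (p₁ 0 0) ∪ F p₁) ≤ j :=
    hface p₁ (Or.inl rfl) _ (hU _ h00.1 h00.2).2.2.2 le_rfl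
  have hV2 : openBdry ω (U (p₁ 0 0) ∪ F p₁ ∪ F p₂) ≤ j :=
    hface p₂ (Or.inr (Or.inl rfl)) _ hV1 (by rw [e₂]; exact Finset.subset_union_left)
  have hV3 : openBdry ω (U (p₁ 0 0) ∪ F p₁ ∪ F p₂ ∪ F p₃) ≤ j :=
    hface p₃ (Or.inr (Or.inr (Or.inl rfl))) _ hV2 (by
      rw [e₃]
      exact Finset.subset_union_left.trans Finset.subset_union_left)
  have hV4 : openBdry ω (U (p₁ 0 0) ∪ F p₁ ∪ F p₂ ∪ F p₃ ∪ F p₄) ≤ j :=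
    hface p₄ (Or.inr (Or.inr (Or.inr (Or.inl rfl)))) _ hV3 (by
      rw [e₄]
      refine (subset_chartUnion U p₁ hK8 hK0).trans ?_
      exact Finset.subset_union_right.trans (Finset.subset_union_left.trans Finset.subset_union_left))
  have hV5 : openBdry ω (U (p₁ 0 0) ∪ F p₁ ∪ F p₂ ∪ F p₃ ∪ F p₄ ∪ F p₅) ≤ j :=
    hface p₅ (Or.inr (Or.inr (Or.inr (Or.inr (Or.inl rfl))))) _ hV4 (by
      rw [e₅]
      refine (subset_chartUnion U p₁ hK0 hK8).trans ?_
      exact Finset.subset_union_right.trans (Finset.subset_union_left.trans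
        (Finset.subset_union_left.trans Finset.subset_union_left)))
  have hV6 : openBdry ω V ≤ j :=
    hface p₆ (Or.inr (Or.inr (Or.inr (Or.inr (Or.inr rfl))))) _ hV5 (by
      rw [e₆]
      refine (subset_chartUnion U p₂ hK8 hK0).trans ?_
      exact Finset.subset_union_right.trans (Finset.subset_union_left.trans
        (Finset.subset_union_left.trans Finset.subset_union_left)))
  -- each face lies in `V`
  have hFV : ∀ p : ℕ → ℕ → Site 3, (p = p₁ ∨ p = p₂ ∨ p = p₃ ∨ p = p₄ ∨ p = p₅ ∨ p = p₆) → F p ⊆ V := by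
    intro p hp
    rcases hp with rfl | rfl | rfl | rfl | rfl | rfl
    · exact Finset.subset_union_right.trans (Finset.subset_union_left.trans (Finset.subset_union_left.trans
        (Finset.subset_union_left.trans (Finset.subset_union_left.trans Finset.subset_union_left))))
    · exact Finset.subset_union_right.trans (Finset.subset_union_left.trans (Finset.subset_union_left.trans
        (Finset.subset_union_left.trans Finset.subset_union_left)))
    · exact Finset.subset_union_right.trans (Finset.subset_union_left.trans (Finset.subset_union_left.trans
        Finset.subset_union_left))
    · exact Finset.subset_union_right.trans (Finset.subset_union_left.trans Finset.subset_union_left)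
    · exact Finset.subset_union_right.trans Finset.subset_union_left
    · exact Finset.subset_union_right
  -- every site of `V` lies in a pocket of a surface translate
  have hVmem : ∀ x ∈ V, ∃ z ∈ box 3 (4 * l), z ∉ box 3 (4 * l - 1) ∧ x ∈ U z := by
    intro x hx
    have hFmem : ∀ p : ℕ → ℕ → Site 3, (p = p₁ ∨ p = p₂ ∨ p = p₃ ∨ p = p₄ ∨ p = p₅ ∨ p = p₆) →
        x ∈ F p → ∃ z ∈ box 3 (4 * l), z ∉ box 3 (4 * l - 1) ∧ x ∈ U z := by
      intro p hp hxF
      simp only [hF, Finset.mem_biUnion, Finset.mem_range] at hxF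
      obtain ⟨s, hs, t, ht, hxU⟩ := hxF
      exact ⟨p s t, (hsurf p hp s hs t ht).1, (hsurf p hp s hs t ht).2, hxU⟩
    simp only [hV, Finset.mem_union] at hx
    rcases hx with (((((hx | hx) | hx) | hx) | hx) | hx) | hx
    · exact ⟨p₁ 0 0, h00.1, h00.2, hx⟩
    · exact hFmem p₁ (Or.inl rfl) hx
    · exact hFmem p₂ (Or.inr (Or.inl rfl)) hx
    · exact hFmem p₃ (Or.inr (Or.inr (Or.inl rfl))) hx
    · exact hFmem p₄ (Or.inr (Or.inr (Or.inr (Or.inl rfl)))) hx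
    · exact hFmem p₅ (Or.inr (Or.inr (Or.inr (Or.inr (Or.inl rfl))))) hx
    · exact hFmem p₆ (Or.inr (Or.inr (Or.inr (Or.inr (Or.inr rfl))))) hx
  -- every surface translate is a chart point, so its pocket lies in `V`
  have hgrid : ∀ z ∈ box 3 (4 * l), z ∉ box 3 (4 * l - 1) → U z ⊆ V := by
    intro z hz hz'
    rw [mem_box] at hz
    rw [mem_box, not_forall, hl1] at hz'
    obtain ⟨i₀, hi₀⟩ := hz'
    have hco : ∀ i, (((z i + c).toNat : ℕ) : ℤ) = z i + c ∧ (z i + c).toNat < K := by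
      intro i
      have h1 := hz i
      have h2 : 0 ≤ z i + c := by rw [hc]; push_cast at h1; omega
      refine ⟨Int.toNat_of_nonneg h2, ?_⟩
      have : ((z i + c).toNat : ℤ) < K := by rw [Int.toNat_of_nonneg h2, hK, hc]; push_cast at h1 ⊢; omega
      exact_mod_cast this
    have hzi : z i₀ = c ∨ z i₀ = -c := by have := hz i₀; rw [hc]; push_cast at this; omega
    fin_cases i₀
    · rcases hzi with h | h
      · refine subset_trans ?_ (hFV p₆ (Or.inr (Or.inr (Or.inr (Or.inr (Or.inr rfl))))))
        have e : p₆ (z 1 + c).toNat (z 2 + c).toNat = z := by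
          ext i; fin_cases i <;> simp [hp₆, (hco 1).1, (hco 2).1]; simpa using h.symm
        rw [← e]; exact subset_chartUnion U p₆ (hco 1).2 (hco 2).2
      · refine subset_trans ?_ (hFV p₁ (Or.inl rfl))
        have e : p₁ (z 1 + c).toNat (z 2 + c).toNat = z := by
          ext i; fin_cases i <;> simp [hp₁, (hco 1).1, (hco 2).1]; simpa using h.symm
        rw [← e]; exact subset_chartUnion U p₁ (hco 1).2 (hco 2).2
    · rcases hzi with h | h
      · refine subset_trans ?_ (hFV p₄ (Or.inr (Or.inr (Or.inr (Or.inl rfl)))))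
        have e : p₄ (z 0 + c).toNat (z 2 + c).toNat = z := by
          ext i; fin_cases i <;> simp [hp₄, (hco 0).1, (hco 2).1]; simpa using h.symm
        rw [← e]; exact subset_chartUnion U p₄ (hco 0).2 (hco 2).2
      · refine subset_trans ?_ (hFV p₂ (Or.inr (Or.inl rfl)))
        have e : p₂ (z 0 + c).toNat (z 2 + c).toNat = z := by
          ext i; fin_cases i <;> simp [hp₂, (hco 0).1, (hco 2).1]; simpa using h.symm
        rw [← e]; exact subset_chartUnion U p₂ (hco 0).2 (hco 2).2
    · rcases hzi with h | h
      · refine subset_trans ?_ (hFV p₅ (Or.inr (Or.inr (Or.inr (Or.inr (Or.inl rfl))))))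
        have e : p₅ (z 0 + c).toNat (z 1 + c).toNat = z := by
          ext i; fin_cases i <;> simp [hp₅, (hco 0).1, (hco 1).1]; simpa using h.symm
        rw [← e]; exact subset_chartUnion U p₅ (hco 0).2 (hco 1).2
      · refine subset_trans ?_ (hFV p₃ (Or.inr (Or.inr (Or.inl rfl))))
        have e : p₃ (z 0 + c).toNat (z 1 + c).toNat = z := by
          ext i; fin_cases i <;> simp [hp₃, (hco 0).1, (hco 1).1]; simpa using h.symm
        rw [← e]; exact subset_chartUnion U p₃ (hco 0).2 (hco 1).2
  refine ⟨V, hV6, ?_, ?_, ?_⟩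
  · -- off the centre floor box
    rw [Finset.disjoint_left]
    intro x hxV hxu
    obtain ⟨z, hz, hz', hxU⟩ := hVmem x hxV
    exact (hwin z hz hz' x hxU).2 hxu
  · -- inside `box (12lu - 1)`
    intro x hxV
    obtain ⟨z, hz, hz', hxU⟩ := hVmem x hxV
    exact (hwin z hz hz' x hxU).1
  · -- the sphere `‖x‖∞ = 4lu` is covered: round `x` down to the grid
    intro x hx hx'
    rw [mem_box] at hx
    rw [mem_box, not_forall, hR1] at hx'
    obtain ⟨i₀, hi₀⟩ := hx'
    simp only [hR] at hx
    have hu0 : (0 : ℤ) ≤ u := by positivity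
    have hround : ∀ i, ∃ s : ℕ, s ≤ 8 * l ∧ 0 ≤ x i + 4 * (l * u : ℕ) - u * s ∧
        x i + 4 * (l * u : ℕ) - u * s < u := by
      intro i
      have h1 := hx i
      have e4 : (((4 * l) * u : ℕ) : ℤ) = 4 * (l * u : ℕ) := by push_cast; ring
      obtain ⟨s, hs, h2, h3⟩ := grid_round (R := 4 * l) hu (y := x i) (by rw [e4]; exact h1.1)
        (by rw [e4]; exact h1.2)
      refine ⟨s, by omega, ?_, ?_⟩
      · have : (x i + (4 * l : ℕ) * u - u * s : ℤ) = x i + 4 * (l * u : ℕ) - u * s := by push_cast; ring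
        rw [← this]; exact h2
      · have : (x i + (4 * l : ℕ) * u - u * s : ℤ) = x i + 4 * (l * u : ℕ) - u * s := by push_cast; ring
        rw [← this]; exact h3
    choose s hs using hround
    set z : Site 3 := fun i => (s i : ℤ) - c with hz
    have hzs : ∀ i, (u : ℤ) * z i = u * s i - 4 * (l * u : ℕ) := by
      intro i; simp only [hz, hc, mul_sub]; push_cast; ring
    have hzb : z ∈ box 3 (4 * l) := by
      rw [mem_box]; intro i; have := (hs i).1; simp only [hz, hc]; push_cast; constructor <;> omega
    have hzb' : z ∉ box 3 (4 * l - 1) := by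
      intro hzm
      have h1 := (mem_box.1 hzm) i₀
      rw [hl1] at h1
      simp only [hz, hc] at h1
      have h2 := (hs i₀).2
      have hx0 : x i₀ = 4 * (l * u : ℕ) ∨ x i₀ = -(4 * (l * u : ℕ)) := by have := hx i₀; omega
      have e8 : (u : ℤ) * (8 * l - 1 : ℤ) = 2 * (4 * (l * u : ℕ)) - u := by push_cast; ring
      rcases hx0 with hx0 | hx0
      · have h3 : (u : ℤ) * s i₀ ≤ u * (8 * l - 1 : ℤ) := mul_le_mul_of_nonneg_left (by omega) hu0
        rw [e8] at h3
        omega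
      · have h3 : (u : ℤ) * 1 ≤ u * s i₀ := mul_le_mul_of_nonneg_left (by omega) hu0
        omega
    have hxz : x ∈ (box 3 n).image (· + (u : ℤ) • z) := by
      rw [mem_image_add_iff, mem_box]
      intro i
      have h1 := (hs i).2
      have h2 := hzs i
      have hun : (u : ℤ) ≤ n := by exact_mod_cast (by omega : u ≤ n)
      simp only [Pi.sub_apply, Pi.smul_apply, smul_eq_mul]
      constructor <;> linarith [h1.1, h1.2]
    exact hgrid z hzb hzb' ((hU z hzb hzb').1 hxz)

end Summit.CriticalPhenomena.PercolationContinuityZ3.Theorems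

end
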